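import Summits.FinalStateConjecture.FinalStateConjecture.Theses.LateLocalKicks
import Literature.Geometry.Lorentzian.AdmissibleMGHDExistence

/-!
# `LateKick` is the summit in costume (crux-strategist r1 census artefact, 2026-08-17)

Crux: `LateLocalKicks.LateKick` (stmt-FinalStateConjecture-17990, rank 2, route
route-FinalStateConjecture-LateLocalKicks).

This file proves, sorry-free, the theorems the STRATEGY-CENSUS cites under `strategy: no-strategy`:

* `SummitKick` := the summit statement `FinalStateConjecture` with its genericity quantifier
  `IsTameChristodoulouGeneric 𝓓 P 1` replaced by ONE-SIDED LOCAL KICKABILITY of the SAME matrix `P`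
  (`LocallyKickable`: through every admissible datum failing `P` passes a jointly smooth family, equal to
  the datum off one compact set, all members admissible, with `P` for all small POSITIVE parameters).
  `summit_is_tameGeneric` records that the summit is literally `∀ X, IsTameChristodoulouGeneric 𝓓 (SummitAt X) 1`.
* `lateKick_iff_summitKick` : modulo the route's three transport items
  (`KickTransport`, `SliceIndependence`, `MGHDExists` — Cauchy stability, slice re-anchoring, CBG),
  `LateKick ↔ SummitKick`.  The "late pinned co-slice" is the only vocabulary separating the crux from
  `SummitKick`, and it is removed in both directions by known theorems (co-slices are reflexive; kicks
  transport back along co-slices).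
* `summit_of_summitKick` : modulo the two packaging items (`OneSidedSuffices`, `TameWitnessOfLocalFamily`)
  and `MGHDExists`, `SummitKick → FinalStateConjecture` — local one-sided kicks are tame witnesses, i.e.
  `SummitKick` is the summit with a NARROWER witness class.  No converse is known or claimed.
* `mghdExists_of_fact` : `MGHDExists` is the named Literature fact `choquetBruhat_geroch_exists_mghd_cauchy`
  restricted to the admissible class (`forall_mem_admissibleVacuumData`).

Hence, modulo five known / provable-now statements, the crux is the summit's own matrix under a
strengthened genericity quantifier: a structured strengthening of `FinalStateConjecture` with no converse
and no tool attached to the strengthening (RULE-N of the birth certificate).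
-/

set_option linter.dupNamespace false
set_option linter.unusedSectionVars false

noncomputable section

namespace Summit.FinalStateConjecture.FinalStateConjecture.Cruxes.LateKick.Costume

open scoped Manifold ContDiff Topology
open Set Filter
open Literature.Geometry.Lorentzian
open Summit.FinalStateConjecture (HasCompleteNullInfinity exteriorOf RaysStayInClosure HasExhaustiveCharts
  IsFutureOriented)
open Summit.FinalStateConjecture.FinalStateConjecture.Theses.LateLocalKicks

section Vocabulary

variable (X : Type) [TopologicalSpace X] [ChartedSpace E3 X] [IsManifold (𝓡 3) ∞ X]
  [T2Space X] [SecondCountableTopology X] [ConnectedSpace X]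

/-- `Q` at one datum: verbatim the let-bound legend `Q` of every item of the route (the settling clause of
the re-typed Statement, for EVERY maximal vacuum Cauchy development). -/
def SettlesAt (D : InitialDataSet (𝓡 3) X) : Prop :=
  ∀ 𝒟 : VacuumCauchyDevelopment D, 𝒟.IsMaximal →
    HasCompleteNullInfinity 𝒟.toCauchyDevelopment ∧
      ∃ (O : Set 𝒟.carrier) (dd : FinalStateDecomposition 𝒟.toSpacetime O 2),
        (∀ i, Kerr.IsSubextremal (dd.mass i) (dd.spin i)) ∧
          O = exteriorOf 𝒟.toCauchyDevelopment dd.charted ∧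
            RaysStayInClosure 𝒟.toCauchyDevelopment O ∧ HasExhaustiveCharts dd ∧ IsFutureOriented dd

/-- The summit matrix at one datum: verbatim the `fun D ↦ …` of `FinalStateConjecture`. -/
def SummitAt (D : InitialDataSet (𝓡 3) X) : Prop :=
  (∃ 𝒟 : VacuumCauchyDevelopment D, 𝒟.IsMaximal) ∧ SettlesAt X D

/-- A LOCAL KICK through `D`: verbatim the let-bound legend `Local` of the route. -/
def IsLocalKick (D : InitialDataSet (𝓡 3) X)
    (G : EuclideanSpace ℝ (Fin 1) → InitialDataSet (𝓡 3) X) : Prop :=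
  InitialDataSet.IsSmoothDataFamily 1 G ∧ G 0 = D ∧ (∀ c, G c ∈ admissibleVacuumData X) ∧
    ∃ K : Set X, IsCompact K ∧ ∀ c, ∀ x ∉ K, (G c).h.inner x = D.h.inner x ∧ (G c).k x = D.k x

/-- A PINNED CO-SLICE: verbatim the let-bound legend `CoSlice` of the route. -/
def IsCoSlice (D D' : InitialDataSet (𝓡 3) X) : Prop :=
  ∃ (𝒟 : VacuumCauchyDevelopment D) (𝒟' : VacuumCauchyDevelopment D') (ψ : 𝒟'.carrier → 𝒟.carrier),
    ContMDiff (𝓡 4) (𝓡 4) ∞ ψ ∧ Topology.IsOpenEmbedding ψ ∧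
      𝒟'.metric.IsIsometricImmersion 𝒟.metric.toPseudoRiemannianMetric ψ ∧
        𝒟'.timeOrientation.PreservesTimeOrientation ψ 𝒟.timeOrientation ∧
          𝒟.metric.IsCauchyHypersurface 𝒟.timeOrientation (Set.range (ψ ∘ 𝒟'.embed)) ∧
            ∃ C : Set X, IsCompact C ∧ ∀ x ∉ C, ψ (𝒟'.embed x) = 𝒟.embed x

/-- ONE-SIDED LOCAL KICKABILITY of a property `P` on the admissible class: through every admissible datum
failing `P` passes a local kick all of whose small positive members satisfy `P`. -/
def LocallyKickable (P : InitialDataSet (𝓡 3) X → Prop) : Prop :=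
  ∀ d ∈ admissibleVacuumData X, ¬ P d →
    ∃ G : EuclideanSpace ℝ (Fin 1) → InitialDataSet (𝓡 3) X, IsLocalKick X d G ∧
      ∃ δ : ℝ, 0 < δ ∧ ∀ c : EuclideanSpace ℝ (Fin 1), 0 < c 0 → c 0 < δ → P (G c)

end Vocabulary

/-- `EarlyKick`: the settling clause `Q` is one-sidedly locally kickable at every admissible datum, on
every data manifold — `LateKick` with the co-slice deleted (`d′ = d`). -/
def EarlyKick : Prop :=
  ∀ (X : Type) [TopologicalSpace X] [ChartedSpace E3 X] [IsManifold (𝓡 3) ∞ X]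
    [T2Space X] [SecondCountableTopology X] [ConnectedSpace X], LocallyKickable X (SettlesAt X)

/-- `SummitKick`: the summit's OWN matrix `(∃ MGHD) ∧ Q` is one-sidedly locally kickable at every
admissible datum — i.e. `FinalStateConjecture` with `IsTameChristodoulouGeneric 𝓓 · 1` replaced by
`LocallyKickable`. -/
def SummitKick : Prop :=
  ∀ (X : Type) [TopologicalSpace X] [ChartedSpace E3 X] [IsManifold (𝓡 3) ∞ X]
    [T2Space X] [SecondCountableTopology X] [ConnectedSpace X], LocallyKickable X (SummitAt X)

/-- The summit is, by `δ`-reduction alone, the tame Christodoulou-genericity of `SummitAt`. -/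
theorem summit_is_tameGeneric :
    _root_.FinalStateConjecture ↔
      ∀ (X : Type) [TopologicalSpace X] [ChartedSpace E3 X] [IsManifold (𝓡 3) ∞ X]
        [T2Space X] [SecondCountableTopology X] [ConnectedSpace X],
        InitialDataSet.IsTameChristodoulouGeneric (admissibleVacuumData X) (SummitAt X) 1 :=
  Iff.rfl

/-- `LateKick` is, by `δ`/`ζ`-reduction alone, "`¬ Q d` ⇒ a co-slice `d′` of `d` carries a local kick into
`Q`". -/
theorem lateKick_iff :
    LateKick ↔
      ∀ (X : Type) [TopologicalSpace X] [ChartedSpace E3 X] [IsManifold (𝓡 3) ∞ X]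
        [T2Space X] [SecondCountableTopology X] [ConnectedSpace X],
        ∀ d ∈ admissibleVacuumData X, ¬ SettlesAt X d →
          ∃ d' ∈ admissibleVacuumData X, IsCoSlice X d d' ∧
            ∃ G' : EuclideanSpace ℝ (Fin 1) → InitialDataSet (𝓡 3) X, IsLocalKick X d' G' ∧
              ∃ δ : ℝ, 0 < δ ∧ ∀ c : EuclideanSpace ℝ (Fin 1), 0 < c 0 → c 0 < δ → SettlesAt X (G' c) :=
  Iff.rfl

/-- `MGHDExists` (the route's shared rank-9 item) is the named Literature fact
`choquetBruhat_geroch_exists_mghd_cauchy` (Choquet-Bruhat–Geroch 1969, Thm. 3) on the admissible class. -/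
theorem mghdExists_of_fact (h : choquetBruhat_geroch_exists_mghd_cauchy) : MGHDExists :=
  h.forall_mem_admissibleVacuumData

/-- Co-slices are reflexive as soon as the datum has a vacuum Cauchy development (`ψ = id`, `C = ∅`;
`DataEmbedding.EmbedsInto.refl`). -/
theorem isCoSlice_refl (X : Type) [TopologicalSpace X] [ChartedSpace E3 X] [IsManifold (𝓡 3) ∞ X]
    [T2Space X] [SecondCountableTopology X] [ConnectedSpace X]
    {d : InitialDataSet (𝓡 3) X} (𝒟 : VacuumCauchyDevelopment d) : IsCoSlice X d d := by
  obtain ⟨ψ, hψ, hopen, hiso, hτ, hcomp⟩ := DataEmbedding.EmbedsInto.refl 𝒟.toDataEmbedding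
  refine ⟨𝒟, 𝒟, ψ, hψ, hopen, hiso, hτ, ?_, ∅, isCompact_empty, fun x _ ↦ congrFun hcomp x⟩
  have : Set.range (ψ ∘ 𝒟.embed) = Set.range 𝒟.embed := by
    rw [show (ψ ∘ 𝒟.embed) = 𝒟.embed from hcomp]
  rw [this]
  exact 𝒟.isCauchyHypersurface

/-- With MGHD existence, the summit matrix and the settling clause agree on admissible data. -/
theorem summitAt_iff_settlesAt (hM : MGHDExists) (X : Type) [TopologicalSpace X] [ChartedSpace E3 X]
    [IsManifold (𝓡 3) ∞ X] [T2Space X] [SecondCountableTopology X] [ConnectedSpace X]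
    {d : InitialDataSet (𝓡 3) X} (hd : d ∈ admissibleVacuumData X) :
    SummitAt X d ↔ SettlesAt X d :=
  ⟨fun h ↦ h.2, fun h ↦ ⟨hM X d hd, h⟩⟩

/-- `SummitKick ↔ EarlyKick` given MGHD existence (the anti-vacuity conjunct is inert). -/
theorem summitKick_iff_earlyKick (hM : MGHDExists) : SummitKick ↔ EarlyKick := by
  constructor
  · intro h X _ _ _ _ _ _ d hd hnQ
    obtain ⟨G, hG, δ, hδ, hgood⟩ :=
      h X d hd (fun hP ↦ hnQ ((summitAt_iff_settlesAt hM X hd).1 hP))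
    exact ⟨G, hG, δ, hδ, fun c hc hcδ ↦ (hgood c hc hcδ).2⟩
  · intro h X _ _ _ _ _ _ d hd hnP
    obtain ⟨G, hG, δ, hδ, hgood⟩ :=
      h X d hd (fun hQ ↦ hnP ((summitAt_iff_settlesAt hM X hd).2 hQ))
    exact ⟨G, hG, δ, hδ, fun c hc hcδ ↦
      (summitAt_iff_settlesAt hM X (hG.2.2.1 c)).2 (hgood c hc hcδ)⟩

/-- `EarlyKick → LateKick`: take the trivial co-slice `d′ = d` (needs one vacuum Cauchy development of `d`,
supplied by `MGHDExists`). -/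
theorem lateKick_of_earlyKick (hM : MGHDExists) : EarlyKick → LateKick := by
  intro h
  refine lateKick_iff.2 fun X _ _ _ _ _ _ d hd hnQ ↦ ?_
  obtain ⟨G, hG, δ, hδ, hgood⟩ := h X d hd hnQ
  obtain ⟨𝒟, -⟩ := hM X d hd
  exact ⟨d, hd, isCoSlice_refl X 𝒟, G, hG, δ, hδ, hgood⟩

/-- `LateKick → EarlyKick` modulo Cauchy-stability transport of kicks (`KickTransport`), slice
independence of `Q` (`SliceIndependence`) and MGHD existence — verbatim the first half of the route's
deciding theorem `closes`. -/
theorem earlyKick_of_lateKick (hTrans : KickTransport) (hSlice : SliceIndependence) (hM : MGHDExists) :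
    LateKick → EarlyKick := by
  intro hLate X _ _ _ _ _ _ d hdA hnQ
  obtain ⟨d', hd'A, hco, G', hloc', δ', hδ', hgood'⟩ := hLate X d hdA hnQ
  obtain ⟨G, hloc, δ, hδ, hfam⟩ := hTrans X d hdA d' hd'A hco G' hloc'
  refine ⟨G, hloc, min δ δ', lt_min hδ hδ', fun c hc0 hcδ ↦ ?_⟩
  exact hSlice X (G c) (hloc.2.2.1 c) (G' c) (hloc'.2.2.1 c)
    (hfam c (by rw [abs_of_pos hc0]; exact lt_of_lt_of_le hcδ (min_le_left _ _)))
    (hM X (G' c) (hloc'.2.2.1 c)) (hgood' c hc0 (lt_of_lt_of_le hcδ (min_le_right _ _)))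


/-! ## Schema: the costume is uniform in the property

For EVERY property `P` of data, "late one-sided local kickability of `P`" is `P`'s tame genericity with a
narrowed witness class, modulo `P`-slice-independence, kick transport and the gauge shear — the route's
items are the instances `P := Q` (`lateKick_iff_lateKickable`, `kickTransport_iff`, `sliceIndependence_iff`,
`oneSidedSuffices_iff` below, all `Iff.rfl`).  The census uses the instance `P := T` (tame censored) to
show that the kick piece of the best decomposition is `PhotonSphereChannels.TameCensorship` in the same
costume (`CensusDT.lean`). -/

section Schema

variable (X : Type) [TopologicalSpace X] [ChartedSpace E3 X] [IsManifold (𝓡 3) ∞ X]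
  [T2Space X] [SecondCountableTopology X] [ConnectedSpace X]

/-- LATE one-sided local kickability of `P` (the shape of `LateKick`, `Q ↦ P`, at one `X`). -/
def LateKickable (P : InitialDataSet (𝓡 3) X → Prop) : Prop :=
  ∀ d ∈ admissibleVacuumData X, ¬ P d →
    ∃ d' ∈ admissibleVacuumData X, IsCoSlice X d d' ∧
      ∃ G' : EuclideanSpace ℝ (Fin 1) → InitialDataSet (𝓡 3) X, IsLocalKick X d' G' ∧
        ∃ δ : ℝ, 0 < δ ∧ ∀ c : EuclideanSpace ℝ (Fin 1), 0 < c 0 → c 0 < δ → P (G' c)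

/-- `P` descends along pinned co-slices (the shape of `SliceIndependence`, `Q ↦ P`, without its MGHD
hypothesis). -/
def SliceIndependent (P : InitialDataSet (𝓡 3) X → Prop) : Prop :=
  ∀ d ∈ admissibleVacuumData X, ∀ d' ∈ admissibleVacuumData X, IsCoSlice X d d' → P d' → P d

/-- Local kicks transport back along pinned co-slices (the shape of `KickTransport` at one `X`). -/
def KicksTransport : Prop :=
  ∀ d ∈ admissibleVacuumData X, ∀ d' ∈ admissibleVacuumData X, IsCoSlice X d d' →
    ∀ G' : EuclideanSpace ℝ (Fin 1) → InitialDataSet (𝓡 3) X, IsLocalKick X d' G' →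
      ∃ G : EuclideanSpace ℝ (Fin 1) → InitialDataSet (𝓡 3) X, IsLocalKick X d G ∧
        ∃ δ : ℝ, 0 < δ ∧ ∀ c : EuclideanSpace ℝ (Fin 1), |c 0| < δ → IsCoSlice X (G c) (G' c)

/-- A local immersed WINDOW FAMILY through `d` escaping into `P` off `0` (the hypothesis shape of
`TameWitnessOfLocalFamily`). -/
def IsWindowFamily (d : InitialDataSet (𝓡 3) X) (P : InitialDataSet (𝓡 3) X → Prop) (ε : ℝ)
    (F : EuclideanSpace ℝ (Fin 1) → InitialDataSet (𝓡 3) X) : Prop :=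
  0 < ε ∧ InitialDataSet.IsSmoothDataFamily 1 F ∧ F 0 = d ∧ InitialDataSet.IsImmersedAtZero 1 F ∧
    (∃ K : Set X, IsCompact K ∧ ∀ c, ∀ x ∉ K, (F c).h.inner x = d.h.inner x ∧ (F c).k x = d.k x) ∧
      (∀ c c' : EuclideanSpace ℝ (Fin 1), |c 0| < ε → |c' 0| < ε → F c = F c' → c = c') ∧
        (∀ c : EuclideanSpace ℝ (Fin 1), |c 0| < ε → F c ∈ admissibleVacuumData X) ∧
          ∀ c : EuclideanSpace ℝ (Fin 1), c ≠ 0 → |c 0| < ε → P (F c)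

/-- One-sided local kicks into `P` shear to window families (the shape of `OneSidedSuffices`, `Q ↦ P`). -/
def OneSidedShear (P : InitialDataSet (𝓡 3) X → Prop) : Prop :=
  ∀ d ∈ admissibleVacuumData X,
    (∃ G : EuclideanSpace ℝ (Fin 1) → InitialDataSet (𝓡 3) X, IsLocalKick X d G ∧
        ∃ δ : ℝ, 0 < δ ∧ ∀ c : EuclideanSpace ℝ (Fin 1), 0 < c 0 → c 0 < δ → P (G c)) →
      ∃ (ε : ℝ) (F : EuclideanSpace ℝ (Fin 1) → InitialDataSet (𝓡 3) X), IsWindowFamily X d P ε F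

variable {X}

/-- Early kicks are late kicks (trivial co-slice), given a vacuum Cauchy development of each datum. -/
theorem lateKickable_of_locallyKickable {P : InitialDataSet (𝓡 3) X → Prop}
    (hdev : ∀ d ∈ admissibleVacuumData X, Nonempty (VacuumCauchyDevelopment d)) :
    LocallyKickable X P → LateKickable X P := by
  intro h d hd hnP
  obtain ⟨G, hG, δ, hδ, hgood⟩ := h d hd hnP
  obtain ⟨𝒟⟩ := hdev d hd
  exact ⟨d, hd, isCoSlice_refl X 𝒟, G, hG, δ, hδ, hgood⟩

/-- Late kicks are early kicks, modulo kick transport and slice independence of `P`. -/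
theorem locallyKickable_of_lateKickable {P : InitialDataSet (𝓡 3) X → Prop}
    (hT : KicksTransport X) (hS : SliceIndependent X P) : LateKickable X P → LocallyKickable X P := by
  intro h d hd hnP
  obtain ⟨d', hd', hco, G', hloc', δ', hδ', hgood'⟩ := h d hd hnP
  obtain ⟨G, hloc, δ, hδ, hfam⟩ := hT d hd d' hd' hco G' hloc'
  refine ⟨G, hloc, min δ δ', lt_min hδ hδ', fun c hc0 hcδ ↦ ?_⟩
  exact hS (G c) (hloc.2.2.1 c) (G' c) (hloc'.2.2.1 c)
    (hfam c (by rw [abs_of_pos hc0]; exact lt_of_lt_of_le hcδ (min_le_left _ _)))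
    (hgood' c hc0 (lt_of_lt_of_le hcδ (min_le_right _ _)))

/-- One-sided local kickability of `P` is tame genericity of `P` with a narrower witness class, modulo the
gauge shear for `P` and the (property-generic) packaging item `TameWitnessOfLocalFamily`. -/
theorem tameGeneric_of_locallyKickable {P : InitialDataSet (𝓡 3) X → Prop}
    (hO : OneSidedShear X P) (hW : TameWitnessOfLocalFamily) :
    LocallyKickable X P → InitialDataSet.IsTameChristodoulouGeneric (admissibleVacuumData X) P 1 := by
  intro h
  refine hW X P fun d hd hnP ↦ ?_
  obtain ⟨ε, F, hF⟩ := hO d hd (h d hd hnP)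
  exact ⟨ε, F, hF⟩

/-- The whole costume for an arbitrary property: late kickability of `P` ⇒ tame genericity of `P`. -/
theorem tameGeneric_of_lateKickable {P : InitialDataSet (𝓡 3) X → Prop}
    (hT : KicksTransport X) (hS : SliceIndependent X P) (hO : OneSidedShear X P)
    (hW : TameWitnessOfLocalFamily) :
    LateKickable X P → InitialDataSet.IsTameChristodoulouGeneric (admissibleVacuumData X) P 1 :=
  fun h ↦ tameGeneric_of_locallyKickable hO hW (locallyKickable_of_lateKickable hT hS h)

/-! ### The route's items are the `P := Q` instances (all by `Iff.rfl`) -/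

theorem lateKick_iff_lateKickable :
    LateKick ↔ ∀ (X : Type) [TopologicalSpace X] [ChartedSpace E3 X] [IsManifold (𝓡 3) ∞ X]
      [T2Space X] [SecondCountableTopology X] [ConnectedSpace X], LateKickable X (SettlesAt X) :=
  Iff.rfl

theorem kickTransport_iff :
    KickTransport ↔ ∀ (X : Type) [TopologicalSpace X] [ChartedSpace E3 X] [IsManifold (𝓡 3) ∞ X]
      [T2Space X] [SecondCountableTopology X] [ConnectedSpace X], KicksTransport X :=
  Iff.rfl

/-- (`SliceIndependence` carries the extra hypothesis "`d′` has an MGHD", inert under `MGHDExists`.) -/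
theorem sliceIndependence_iff :
    SliceIndependence ↔ ∀ (X : Type) [TopologicalSpace X] [ChartedSpace E3 X] [IsManifold (𝓡 3) ∞ X]
      [T2Space X] [SecondCountableTopology X] [ConnectedSpace X],
      ∀ d ∈ admissibleVacuumData X, ∀ d' ∈ admissibleVacuumData X, IsCoSlice X d d' →
        (∃ 𝒟' : VacuumCauchyDevelopment d', 𝒟'.IsMaximal) → SettlesAt X d' → SettlesAt X d :=
  Iff.rfl

theorem sliceIndependent_of_sliceIndependence (hS : SliceIndependence) (hM : MGHDExists)
    (X : Type) [TopologicalSpace X] [ChartedSpace E3 X] [IsManifold (𝓡 3) ∞ X]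
    [T2Space X] [SecondCountableTopology X] [ConnectedSpace X] : SliceIndependent X (SettlesAt X) :=
  fun d hd d' hd' hco h' ↦ (sliceIndependence_iff.1 hS) X d hd d' hd' hco (hM X d' hd') h'

theorem oneSidedSuffices_iff :
    OneSidedSuffices ↔ ∀ (X : Type) [TopologicalSpace X] [ChartedSpace E3 X] [IsManifold (𝓡 3) ∞ X]
      [T2Space X] [SecondCountableTopology X] [ConnectedSpace X], OneSidedShear X (SettlesAt X) :=
  Iff.rfl

end Schema

/-- **The costume, part 1.** Modulo the three transport items, `LateKick` IS `SummitKick`: the summit's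
own matrix made generic by one-sided local kicks. -/
theorem lateKick_iff_summitKick (hTrans : KickTransport) (hSlice : SliceIndependence) (hM : MGHDExists) :
    LateKick ↔ SummitKick :=
  ⟨fun h ↦ (summitKick_iff_earlyKick hM).2 (earlyKick_of_lateKick hTrans hSlice hM h),
    fun h ↦ lateKick_of_earlyKick hM ((summitKick_iff_earlyKick hM).1 h)⟩

/-- **The costume, part 2.** Modulo the two packaging items and MGHD existence, one-sided local
kickability of the summit matrix implies its tame genericity, i.e. the summit — verbatim the second half
of `closes`.  (`LocallyKickable P → IsTameChristodoulouGeneric 𝓓 P 1`: a narrower witness class.) -/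
theorem summit_of_summitKick (hOne : OneSidedSuffices) (hTame : TameWitnessOfLocalFamily)
    (hM : MGHDExists) : SummitKick → _root_.FinalStateConjecture := by
  intro hK X _ _ _ _ _ _
  refine hTame X _ ?_
  intro d hdA hnP
  obtain ⟨G, hloc, δ, hδ, hgood⟩ := (summitKick_iff_earlyKick hM).1 hK X d hdA
    (fun hQ ↦ hnP ⟨hM X d hdA, hQ⟩)
  obtain ⟨ε, F, hε, hF, hF0, hFimm, hFK, hFinj, hFA, hFQ⟩ := hOne X d hdA ⟨G, hloc, δ, hδ, hgood⟩
  exact ⟨ε, F, hε, hF, hF0, hFimm, hFK, hFinj, hFA, fun c hc hcε ↦ ⟨hM X (F c) (hFA c hcε), hFQ c hc hcε⟩⟩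

/-- **Summary.** Modulo the five known / provable-now items of the route, the rank-2 crux is equivalent to
`SummitKick` and `SummitKick` implies the summit: the crux is `FinalStateConjecture` with its genericity
quantifier strengthened from "tame immersed one-parameter families" to "compactly supported one-sided
families", and nothing else. -/
theorem costume (hTrans : KickTransport) (hSlice : SliceIndependence) (hOne : OneSidedSuffices)
    (hTame : TameWitnessOfLocalFamily) (hM : MGHDExists) :
    (LateKick ↔ SummitKick) ∧ (SummitKick → _root_.FinalStateConjecture) :=
  ⟨lateKick_iff_summitKick hTrans hSlice hM, summit_of_summitKick hOne hTame hM⟩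

end Summit.FinalStateConjecture.FinalStateConjecture.Cruxes.LateKick.Costume

end
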